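import Mathlib
import Summits.Ventures.HodgeRepro.Tier4.Line1.RTFSetting
import Summits.Ventures.HodgeRepro.Tier4.Line1.RtfGeometric
import Summits.Ventures.HodgeRepro.Tier4.Line4.KernelL1
import Summits.Ventures.HodgeRepro.Tier4.Line4.LatticeCount
import Summits.Ventures.HodgeRepro.Tier4.Line4.L1Class

/-!
# Tier4/Line4/RtfGeometricL1 — the geometric side of the relative trace formula for an `L¹` test function:
`J(f) = ∑'_o O_o(f)` over ALL rational double cosets, the family summable

Blind re-derivation cell `pub-hodge-repro`, Tier 4 «prove the step» (README §9–§10), seat t4-L4-p2 (prover, LINE L4,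
gen 4).  Tree path `lean/Summits/Ventures/HodgeRepro/Tier4/Line4/RtfGeometricL1.lean`.  Mathlib-level; no literature;
no `def`.  This is §15 (2) of plan-4 g4's statements file (`RtfGeometricL1`, work/v33, re-typed per the lead's (R-12)
ruling (α) S14799) as a THEOREM over the generic `RTF.Setting G` — the `L¹` twin of L1-p2's `rtf_geometric`
(`S.J χ χ' f = ∑ᶠ o, S.orbital χ χ' o f` for a compactly supported `f`, where the sum is finite).

THE PROOF (two applications of `hasSum_integral_of_summable_integral_norm`, on the layer `KernelL1`).  Write
`F_o(t, t') := K_f^o(t, t') χ(t) conj χ'(t')` for the partial kernel of the double coset `o`.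
* Pointwise, for `t ∈ closure D_T`, `t' ∈ closure D_{T′}` and any finite set `s` of double cosets,
  `∑_{o ∈ s} ‖F_o(t, t')‖ ≤ ∑_{o ∈ s} ∑'_{γ ∈ o} ‖f(t⁻¹ γ t')‖ ≤ ∑'_γ ‖f(t⁻¹ γ t')‖ ≤ M` — the characters are unitary, the
  partial kernel is bounded by its fibre sum (`norm_partialKernel_le_tsum_fiber`), the fibre sums regroup to the full
  Poincaré series (`hasSum_tsum_norm_fiber`), and `M` is the uniform (α)-bound on the closures
  (`exists_bound_tsum_norm_closure`).
* INNER: each `F_o(t, ·)` is integrable on `D_{T′}` (`integrableOn_partialKernel_mul_DT'`), and the partial sums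
  `∑_{o ∈ s} ∫_{D_{T′}} ‖F_o(t, t')‖ dt' = ∫_{D_{T′}} ∑_{o ∈ s} ‖F_o‖ ≤ M · μ_{T′}(D_{T′})` are bounded, so
  `o ↦ ∫ ‖F_o(t, ·)‖` is summable and `∑'_o ∫_{D_{T′}} F_o(t, t') dt' = ∫_{D_{T′}} ∑'_o F_o(t, t') dt' = ∫_{D_{T′}} K_f χ conj χ'`
  (`kernel_eq_tsum_partialKernel`).
* OUTER: each `t ↦ ∫_{D_{T′}} F_o(t, t') dt'` is integrable on `D_T` (`integrableOn_integral_partialKernel_mul_DT`), with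
  the same bounded partial sums `∑_{o ∈ s} ∫_{D_T} ‖∫_{D_{T′}} F_o‖ ≤ M · μ_{T′}(D_{T′}) · μ_T(D_T)`, so
  `∑'_o O_o(f) = ∫_{D_T} ∑'_o ∫_{D_{T′}} F_o = ∫_{D_T} ∫_{D_{T′}} K_f χ conj χ' = J(f)`.
No Tonelli on `ℝ≥0∞` is used: the summability comes from bounded partial sums of non-negative terms
(`summable_of_sum_le`).  Countability of the rational points (hence of the double cosets) comes from the second
countability of `G` (`countable_Gk`); the adelic instance has it (`secondCountable_GA`).

Nothing here says anything about the status of the Hodge conjecture for CM abelian varieties, which is NOT proved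
(HC_CM is NOT proved by anyone in this repository).
-/

set_option autoImplicit false

noncomputable section

namespace Summit.Ventures.HodgeRepro.Tier4.Line4

open MeasureTheory Topology Filter Set Summit.Ventures.HodgeRepro.Tier4 Summit.Ventures.HodgeRepro.Tier4.Line1
  Summit.Ventures.HodgeRepro.Tier4.Line1.RTF

variable {G : Type} [Group G] [TopologicalSpace G] [IsTopologicalGroup G] [MeasurableSpace G] [BorelSpace G]
  (S : Setting G)

section GeometricL1

variable [SecondCountableTopology G]

omit [IsTopologicalGroup G] [BorelSpace G] [SecondCountableTopology G] in
/-- The rational double cosets are countable when the rational points are (a quotient of a countable type). -/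
theorem countable_Orbit [Countable S.Gk] : Countable S.Orbit :=
  inferInstanceAs (Countable (Quotient (DoubleCoset.setoid (S.Tk : Set S.Gk) (S.T'k : Set S.Gk))))

omit [IsTopologicalGroup G] [BorelSpace G] [SecondCountableTopology G] in
/-- **Bounded partial sums of the partial-kernel integrands**: for `t ∈ closure D_T`, `t' ∈ closure D_{T′}` and a finite
set `s` of double cosets, `∑_{o ∈ s} ‖K_f^o(t, t') χ(t) conj χ'(t')‖ ≤ M`, the uniform (α)-bound. -/
theorem sum_norm_partialKernel_mul_le {f : G → ℂ}
    (hP : L1Class.PoincareSummable S f)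
    {χ : S.T → ℂ} (hu : ∀ a, ‖χ a‖ = 1) {χ' : S.T' → ℂ} (hu' : ∀ a, ‖χ' a‖ = 1) {M : ℝ}
    (hM : ∀ t ∈ closure S.DT, ∀ t' ∈ closure S.DT', ∑' γ : S.Gk, ‖f ((t : G)⁻¹ * γ * t')‖ ≤ M)
    (s : Finset S.Orbit) {t : S.T} (ht : t ∈ closure S.DT) {t' : S.T'} (ht' : t' ∈ closure S.DT') :
    ∑ o ∈ s, ‖S.partialKernel o f t t' * χ t * starRingEnd ℂ (χ' t')‖ ≤ M := by
  have hs := summable_norm_of_poincareUniform S hP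
  calc ∑ o ∈ s, ‖S.partialKernel o f t t' * χ t * starRingEnd ℂ (χ' t')‖
      = ∑ o ∈ s, ‖S.partialKernel o f t t'‖ := by
        refine Finset.sum_congr rfl fun o _ => ?_
        rw [norm_mul, norm_mul, Complex.norm_conj, hu, hu', mul_one, mul_one]
    _ ≤ ∑ o ∈ s, ∑' γ : {γ : S.Gk // S.orbitOf γ = o}, ‖f ((t : G)⁻¹ * γ.1 * t')‖ :=
        Finset.sum_le_sum fun o _ => norm_partialKernel_le_tsum_fiber S hs o t t'
    _ ≤ ∑' o : S.Orbit, ∑' γ : {γ : S.Gk // S.orbitOf γ = o}, ‖f ((t : G)⁻¹ * γ.1 * t')‖ :=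
        (hasSum_tsum_norm_fiber S hs t t').summable.sum_le_tsum s
          (fun o _ => tsum_nonneg fun γ => norm_nonneg _)
    _ = ∑' γ : S.Gk, ‖f ((t : G)⁻¹ * γ * t')‖ := (hasSum_tsum_norm_fiber S hs t t').tsum_eq
    _ ≤ M := hM t ht t' ht'

/-- **The inner expansion**: for `t ∈ closure D_T`, the inner integrals of the partial kernels sum to the inner integral
of the kernel, `∑'_o ∫_{D_{T′}} K_f^o(t, t') χ(t) conj χ'(t') dt' = ∫_{D_{T′}} K_f(t, t') χ(t) conj χ'(t') dt'`
(`HasSum` form). -/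
theorem hasSum_integral_partialKernel_DT' [Countable S.Gk] {f : G → ℂ} (hf : Continuous f)
    (hP : L1Class.PoincareSummable S f)
    {χ : S.T → ℂ} (hu : ∀ a, ‖χ a‖ = 1) {χ' : S.T' → ℂ} (hχ' : Continuous χ') (hu' : ∀ a, ‖χ' a‖ = 1)
    {t : S.T} (ht : t ∈ closure S.DT) :
    HasSum (fun o : S.Orbit => ∫ t' in S.DT', S.partialKernel o f t t' * χ t * starRingEnd ℂ (χ' t') ∂S.μT')
      (∫ t' in S.DT', S.kernel f t t' * χ t * starRingEnd ℂ (χ' t') ∂S.μT') := by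
  have hs := summable_norm_of_poincareUniform S hP
  obtain ⟨M, hM⟩ := exists_bound_tsum_norm_closure S hP
  have hint : ∀ o : S.Orbit,
      Integrable (fun t' : S.T' => S.partialKernel o f t t' * χ t * starRingEnd ℂ (χ' t')) (S.μT'.restrict S.DT') :=
    fun o => integrableOn_partialKernel_mul_DT' S hf hP o χ hχ' hu' ht
  have hsum : Summable (fun o : S.Orbit =>
      ∫ t' in S.DT', ‖S.partialKernel o f t t' * χ t * starRingEnd ℂ (χ' t')‖ ∂S.μT') := by
    refine summable_of_sum_le (fun o => integral_nonneg fun _ => norm_nonneg _) (c := M * S.μT'.real S.DT')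
      fun s => ?_
    rw [← integral_finsetSum _ fun o _ => (hint o).norm]
    refine (Real.le_norm_self _).trans (norm_setIntegral_le_of_norm_le_const (measure_DT'_lt_top S)
      fun t' ht' => ?_)
    rw [Real.norm_of_nonneg (Finset.sum_nonneg fun o _ => norm_nonneg _)]
    exact sum_norm_partialKernel_mul_le S hP hu hu' hM s ht (subset_closure ht')
  haveI : Countable S.Orbit := countable_Orbit S
  have heq : (∫ t' in S.DT', S.kernel f t t' * χ t * starRingEnd ℂ (χ' t') ∂S.μT') =
      ∫ t' in S.DT', ∑' o : S.Orbit, S.partialKernel o f t t' * χ t * starRingEnd ℂ (χ' t') ∂S.μT' := by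
    refine integral_congr_ae (Eventually.of_forall fun t' => ?_)
    simp only
    rw [kernel_eq_tsum_partialKernel S hs, tsum_mul_right, tsum_mul_right]
  rw [heq]
  exact hasSum_integral_of_summable_integral_norm hint hsum

/-- **THE GEOMETRIC SIDE FOR AN `L¹` TEST FUNCTION** (§15 (2), `RtfGeometricL1` as a theorem): for continuous unitary
characters `χ`, `χ'` and a continuous `f` with the (α)-form Poincaré bound, the orbital terms over ALL rational double
cosets are summable and `J(f) = ∑'_o O_o(f)`.  The hypotheses are those of the display (`Common.IsTestL1 S f` gives
`Continuous f`; integrability of `f` is not used on the geometric side). -/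
theorem rtf_geometric_L1 {χ : S.T → ℂ} {χ' : S.T' → ℂ} (hχ : S.IsCharacter χ) (hχ' : S.IsCharacter' χ')
    {f : G → ℂ} (hf : Continuous f)
    (hP : L1Class.PoincareSummable S f) :
    Summable (fun o : S.Orbit => S.orbital χ χ' o f) ∧ S.J χ χ' f = ∑' o : S.Orbit, S.orbital χ χ' o f := by
  haveI : Countable S.Gk := countable_Gk S
  haveI : Countable S.Orbit := countable_Orbit S
  obtain ⟨M, hM⟩ := exists_bound_tsum_norm_closure S hP
  have hint : ∀ o : S.Orbit, Integrable (fun t : S.T =>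
      ∫ t' in S.DT', S.partialKernel o f t t' * χ t * starRingEnd ℂ (χ' t') ∂S.μT') (S.μT.restrict S.DT) :=
    fun o => integrableOn_integral_partialKernel_mul_DT S hf hP o hχ.cont hχ.unit hχ'.cont hχ'.unit
  have hsum : Summable (fun o : S.Orbit => ∫ t in S.DT,
      ‖∫ t' in S.DT', S.partialKernel o f t t' * χ t * starRingEnd ℂ (χ' t') ∂S.μT'‖ ∂S.μT) := by
    refine summable_of_sum_le (fun o => integral_nonneg fun _ => norm_nonneg _)
      (c := M * S.μT'.real S.DT' * S.μT.real S.DT) fun s => ?_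
    rw [← integral_finsetSum _ fun o _ => (hint o).norm]
    refine (Real.le_norm_self _).trans (norm_setIntegral_le_of_norm_le_const (measure_DT_lt_top S)
      fun t ht => ?_)
    rw [Real.norm_of_nonneg (Finset.sum_nonneg fun o _ => norm_nonneg _)]
    have hintT' : ∀ o : S.Orbit, Integrable
        (fun t' : S.T' => S.partialKernel o f t t' * χ t * starRingEnd ℂ (χ' t')) (S.μT'.restrict S.DT') :=
      fun o => integrableOn_partialKernel_mul_DT' S hf hP o χ hχ'.cont hχ'.unit (subset_closure ht)
    calc ∑ o ∈ s, ‖∫ t' in S.DT', S.partialKernel o f t t' * χ t * starRingEnd ℂ (χ' t') ∂S.μT'‖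
        ≤ ∑ o ∈ s, ∫ t' in S.DT', ‖S.partialKernel o f t t' * χ t * starRingEnd ℂ (χ' t')‖ ∂S.μT' :=
          Finset.sum_le_sum fun o _ => norm_integral_le_integral_norm _
      _ = ∫ t' in S.DT', ∑ o ∈ s, ‖S.partialKernel o f t t' * χ t * starRingEnd ℂ (χ' t')‖ ∂S.μT' :=
          (integral_finsetSum _ fun o _ => (hintT' o).norm).symm
      _ ≤ M * S.μT'.real S.DT' := by
          refine (Real.le_norm_self _).trans (norm_setIntegral_le_of_norm_le_const (measure_DT'_lt_top S)
            fun t' ht' => ?_)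
          rw [Real.norm_of_nonneg (Finset.sum_nonneg fun o _ => norm_nonneg _)]
          exact sum_norm_partialKernel_mul_le S hP hχ.unit hχ'.unit hM s (subset_closure ht) (subset_closure ht')
  have h := hasSum_integral_of_summable_integral_norm hint hsum
  have hJ : S.J χ χ' f = ∫ t in S.DT, ∑' o : S.Orbit,
      ∫ t' in S.DT', S.partialKernel o f t t' * χ t * starRingEnd ℂ (χ' t') ∂S.μT' ∂S.μT := by
    unfold Setting.J
    apply RTF.Geometric.setIntegral_congr_of_eqOn_closure
    intro t ht
    exact (hasSum_integral_partialKernel_DT' S hf hP hχ.unit hχ'.cont hχ'.unit ht).tsum_eq.symm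
  refine ⟨h.summable, ?_⟩
  rw [hJ]
  exact h.tsum_eq.symm

/-- **THE DISPLAY (2) IS A THEOREM**: `L1Class.RtfGeometricL1 S` holds for every second-countable setting (the adelic
instance is one: `secondCountable_GA`). -/
theorem rtfGeometricL1_holds : L1Class.RtfGeometricL1 S :=
  fun _ _ hχ hχ' _ hf hP => rtf_geometric_L1 S hχ hχ' hf.1 hP

omit [SecondCountableTopology G] in
/-- **THE DISPLAY (1′) IS A THEOREM**: `L1Class.PoincareOfConv S` for every setting
(`LatticeCount.poincareUniform_conv_of_isTestL1`). -/
theorem poincareOfConv_holds : L1Class.PoincareOfConv S :=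
  fun _ _ h₁ h₂ => poincareUniform_conv_of_isTestL1 S h₁ h₂

end GeometricL1

end Summit.Ventures.HodgeRepro.Tier4.Line4

end
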